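import Summits.Ventures.PackingBounds.Configurations.G10
import Summits.Ventures.PackingBounds.Kissing.DimensionEleven

/-!
# Ganzhinov's kissing configuration in dimension `11`: `κ(11) ≥ 592` in Lean

Framing: lottery ticket; floor = certified bounds/negative ranges. Venture `PackingBounds` (cell
`pub-packcert`, seat `pub-packcert-energy`).

The second construction of Ganzhinov, *Highly symmetric lines* §5.4: embed the `10`-dimensional configuration in
`ℝ¹¹ = ℝ¹⁰ × ℝ`, keep `Φ₂` with all six phases (`270`) and `Φ₁` with the four phases `±1, ±ω` (`160`) at height `0`,
replace the remaining copy `±ω² Φ₁` by the `160` vectors `((√3/2) c, ±1/2)` and add the poles `(0, ±1)`: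
`270 + 160 + 160 + 2 = 592` unit vectors with pairwise inner products `≤ 1/2` — **`κ(11) ≥ 592`** (`exists_kissing_592`).
This improves the tree's `κ(11) ≥ 582` (`KissingConstructionA.lean`); the record is `593` (AlphaEvolve 2025, numerical
coordinates not held). In the data of `G10.lean` (representatives `rep i`, phases `rot^k`, integer form `idot`): the
points are `mk c (rot^k (rep i)) a = (c · rv (rot^k (rep i)), a)` with `(c, a) = (1/12, 0)` for the flat part
(`i ≥ 40`, or `i < 40` with `k ∈ {0, 2, 3, 5}`), `(√3/24, ±1/2)` for the lifted copy (`i < 40`, `k ∈ {1, 4}`) and `(0, ±1)`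
for the poles, and `⟪mk c u a, mk c' v b⟫ = c c' · idot u v + a b` (`inner_mk`). Besides the facts of `G10.lean` one more
kernel fact is used: two vectors of the lifted copy have `idot ≤ 48` (real part of the Hermitian product `≤ 1/3`:
within `Φ₁` the products of absolute value `1/√3` are purely imaginary).

## References
* M. Ganzhinov, *Highly symmetric lines*, arXiv:2207.08266, §5.4 and Table 2; Linear Algebra Appl. 722 (2025) 12–37. [`Ganzhinov2022`]
-/

namespace Summit.Ventures.PackingBounds.Config.G11

open Finset WithLp Summit.Ventures.PackingBounds.Config.G10

/-! ### One more kernel fact: the lifted copy -/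

set_option maxRecDepth 100000 in
/-- Within `Φ₁` (`i, j < 40`) at relative phase `±1`: `idot ≤ 48`. -/
theorem idot_copyC : ∀ i < 40, ∀ j < 40, (i = j ∨ idot (rep i) (rep j) ≤ 48) ∧ idot (rotn 3 (rep i)) (rep j) ≤ 48 := by
  decide +kernel

/-- The lifted copy: phases `k, k' ∈ {1, 4}`, `(i, k) ≠ (j, k')`, `i, j < 40` ⇒ `idot ≤ 48`. -/
theorem idot_lift_le {i j k k' : ℕ} (hi : i < 40) (hj : j < 40) (hk : k = 1 ∨ k = 4) (hk' : k' = 1 ∨ k' = 4)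
    (hne : ¬ (i = j ∧ k = k')) : idot (rotn k (rep i)) (rotn k' (rep j)) ≤ 48 := by
  rcases hk with rfl | rfl <;> rcases hk' with rfl | rfl
  · have h := idot_rotn_rotn (rep i) (rep j) 0 1
    rw [h]; exact ((idot_copyC i hi j hj).1).resolve_left fun e => hne ⟨e, rfl⟩
  · have h := idot_rotn_rotn (rep i) (rep j) 3 1
    rw [h, idot_comm]; exact (idot_copyC j hj i hi).2
  · have h := idot_rotn_rotn (rep j) (rep i) 3 1
    rw [idot_comm, h, idot_comm]; exact (idot_copyC i hi j hj).2
  · have h := idot_rotn_rotn (rep i) (rep j) 0 4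
    rw [h]; exact ((idot_copyC i hi j hj).1).resolve_left fun e => hne ⟨e, rfl⟩

/-- Any two configuration vectors of `G10` have `idot ≤ 144`. -/
theorem idot_le_144 {i j k k' : ℕ} (hi : i < 85) (hj : j < 85) (hk : k < 6) (hk' : k' < 6) :
    idot (rotn k (rep i)) (rotn k' (rep j)) ≤ 144 := by
  by_cases h : i = j ∧ k = k'
  · obtain ⟨rfl, rfl⟩ := h; rw [idot_rotn_self hi]
  · exact (idot_le hi hj hk hk' h).trans (by norm_num)

/-! ### Points of `ℝ¹¹` -/

/-- The coordinate sums of the real model give `idot`. -/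
theorem sum_rvf (u v : Fin 5 → ℤ × ℤ) : ∑ i : Fin 10, rvf v i * rvf u i = (idot u v : ℝ) := by
  have h := inner_rv u v
  rw [rv, rv, EuclideanSpace.inner_toLp_toLp, dotProduct] at h
  simpa only [star_trivial] using h

/-- The point `(c · rv u, a) ∈ ℝ¹¹`. -/
noncomputable def mk (c : ℝ) (u : Fin 5 → ℤ × ℤ) (a : ℝ) : EuclideanSpace ℝ (Fin 11) := toLp 2 (Fin.snoc (c • rvf u) a)

/-- **`⟪mk c u a, mk c' v b⟫ = c c' · idot u v + a b`.** -/
theorem inner_mk (c c' a b : ℝ) (u v : Fin 5 → ℤ × ℤ) :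
    inner ℝ (mk c u a) (mk c' v b) = c * c' * (idot u v : ℝ) + a * b := by
  rw [mk, mk, EuclideanSpace.inner_toLp_toLp, dotProduct, Fin.sum_univ_castSucc]
  simp only [Fin.snoc_castSucc, Fin.snoc_last, star_trivial, Pi.smul_apply, smul_eq_mul]
  rw [← sum_rvf u v, Finset.mul_sum]
  have : ∀ i : Fin 10, c' * rvf v i * (c * rvf u i) = c * c' * (rvf v i * rvf u i) := fun i => by ring
  simp only [this]; ring

/-! ### The configuration -/

/-- Index set; rule: `s = 0` flat (`i ≥ 40`, or `i < 40` with `k ∉ {1, 4}`), `s ∈ {1, 2}` lifted (`i < 40`, `k ∈ {1, 4}`),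
`s ∈ {3, 4}` the two poles (`i = k = 0`). -/
def idx : Finset ((ℕ × ℕ) × ℕ) := ((range 85 ×ˢ range 6) ×ˢ range 5).filter fun q =>
  (q.2 = 0 ∧ (40 ≤ q.1.1 ∨ (q.1.2 ≠ 1 ∧ q.1.2 ≠ 4))) ∨ ((q.2 = 1 ∨ q.2 = 2) ∧ q.1.1 < 40 ∧ (q.1.2 = 1 ∨ q.1.2 = 4)) ∨
    ((q.2 = 3 ∨ q.2 = 4) ∧ q.1.1 = 0 ∧ q.1.2 = 0)

set_option maxRecDepth 100000 in
/-- `270 + 160 + 160 + 2 = 592` indices. -/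
theorem card_idx : idx.card = 592 := by decide +kernel

/-- Membership in `idx`. -/
theorem mem_idx {q : (ℕ × ℕ) × ℕ} : q ∈ idx ↔ (q.1.1 < 85 ∧ q.1.2 < 6) ∧ q.2 < 5 ∧
    ((q.2 = 0 ∧ (40 ≤ q.1.1 ∨ (q.1.2 ≠ 1 ∧ q.1.2 ≠ 4))) ∨ ((q.2 = 1 ∨ q.2 = 2) ∧ q.1.1 < 40 ∧ (q.1.2 = 1 ∨ q.1.2 = 4)) ∨
      ((q.2 = 3 ∨ q.2 = 4) ∧ q.1.1 = 0 ∧ q.1.2 = 0)) := by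
  simp only [idx, mem_filter, mem_product, mem_range, and_assoc]

attribute [irreducible] idx

/-- Scale of the `ℝ¹⁰` part. -/
noncomputable def coefOf (s : ℕ) : ℝ := if s = 0 then 1 / 12 else if s ≤ 2 then Real.sqrt 3 / 24 else 0

/-- Last coordinate. -/
noncomputable def lastOf (s : ℕ) : ℝ :=
  if s = 0 then 0 else if s = 1 then 1 / 2 else if s = 2 then -(1 / 2) else if s = 3 then 1 else -1

/-- Values at `s = 0`. -/
theorem coefOf_zero : coefOf 0 = 1 / 12 := by simp [coefOf]

/-- Values at `s = 0`. -/
theorem lastOf_zero : lastOf 0 = 0 := by simp [lastOf]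

/-- The point attached to an index. -/
noncomputable def pt (q : (ℕ × ℕ) × ℕ) : EuclideanSpace ℝ (Fin 11) := mk (coefOf q.2) (rotn q.1.2 (rep q.1.1)) (lastOf q.2)

/-- **Ganzhinov's `11`-dimensional kissing configuration** (`592` points of `S¹⁰`). [cite: Ganzhinov2022, §5.4] -/
noncomputable def conf : Finset (EuclideanSpace ℝ (Fin 11)) := idx.image pt

/-- `(√3)² = 3` and `√3 ≤ 2`. -/
theorem sqrt3_facts : Real.sqrt 3 * Real.sqrt 3 = 3 ∧ Real.sqrt 3 ≤ 2 := by
  have h := Real.mul_self_sqrt (show (0 : ℝ) ≤ 3 by norm_num)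
  exact ⟨h, by nlinarith [Real.sqrt_nonneg 3]⟩

/-- Every point is a unit vector. -/
theorem norm_pt {q : (ℕ × ℕ) × ℕ} (hq : q ∈ idx) : ‖pt q‖ = 1 := by
  obtain ⟨⟨hi, hk⟩, hs, -⟩ := mem_idx.mp hq
  have h := inner_mk (coefOf q.2) (coefOf q.2) (lastOf q.2) (lastOf q.2) (rotn q.1.2 (rep q.1.1)) (rotn q.1.2 (rep q.1.1))
  rw [idot_rotn_self hi, real_inner_self_eq_norm_sq] at h
  change ‖pt q‖ ^ 2 = _ at h
  have h1 : ‖pt q‖ ^ 2 = 1 := by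
    rw [h]
    obtain ⟨h3, -⟩ := sqrt3_facts
    have : q.2 = 0 ∨ q.2 = 1 ∨ q.2 = 2 ∨ q.2 = 3 ∨ q.2 = 4 := by omega
    rcases this with e | e | e | e | e <;> simp [coefOf, lastOf, e] <;> nlinarith [h3]
  nlinarith [norm_nonneg (pt q)]

/-- Distinct indices give inner product `≤ 1/2`. -/
theorem inner_pt_le {q r : (ℕ × ℕ) × ℕ} (hq : q ∈ idx) (hr : r ∈ idx) (hne : q ≠ r) : inner ℝ (pt q) (pt r) ≤ 1 / 2 := by
  obtain ⟨⟨i, k⟩, s⟩ := q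
  obtain ⟨⟨j, k'⟩, s'⟩ := r
  obtain ⟨⟨hi, hk⟩, hs5, hs⟩ := mem_idx.mp hq
  obtain ⟨⟨hj, hk'⟩, hs5', hs'⟩ := mem_idx.mp hr
  simp only at hi hk hs5 hs hj hk' hs5' hs' ⊢
  change inner ℝ (mk (coefOf s) (rotn k (rep i)) (lastOf s)) (mk (coefOf s') (rotn k' (rep j)) (lastOf s')) ≤ 1 / 2
  rw [inner_mk]
  obtain ⟨h3, h32⟩ := sqrt3_facts
  have hs0 := Real.sqrt_nonneg 3
  set D := idot (rotn k (rep i)) (rotn k' (rep j)) with hD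
  have hD144 : (D : ℝ) ≤ 144 := by exact_mod_cast idot_le_144 hi hj hk hk'
  have hD72 : ¬ (i = j ∧ k = k') → (D : ℝ) ≤ 72 := fun h => by exact_mod_cast idot_le hi hj hk hk' h
  rcases hs with ⟨rfl, hA⟩ | ⟨hsB, hiB, hkB⟩ | ⟨hsC, rfl, rfl⟩ <;>
    rcases hs' with ⟨rfl, hA'⟩ | ⟨hsB', hiB', hkB'⟩ | ⟨hsC', rfl, rfl⟩
  · -- flat / flat
    have h72 := hD72 fun h => hne (by obtain ⟨rfl, rfl⟩ := h; rfl)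
    rw [coefOf_zero, lastOf_zero]; nlinarith
  · -- flat / lifted
    have hkk : ¬ (i = j ∧ k = k') := by
      rintro ⟨rfl, rfl⟩; rcases hA with h | ⟨h1, h4⟩; · omega
      · rcases hkB' with h | h <;> omega
    have h72 := hD72 hkk
    have e1 : coefOf s' = Real.sqrt 3 / 24 := by rcases hsB' with rfl | rfl <;> simp [coefOf]
    rw [coefOf_zero, lastOf_zero, e1, zero_mul, add_zero]; nlinarith
  · -- flat / pole
    have e1 : coefOf s' = 0 := by rcases hsC' with rfl | rfl <;> simp [coefOf]
    rw [lastOf_zero, e1, mul_zero, zero_mul, zero_mul, zero_add]; norm_num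
  · -- lifted / flat
    have hkk : ¬ (i = j ∧ k = k') := by
      rintro ⟨rfl, rfl⟩; rcases hA' with h | ⟨h1, h4⟩; · omega
      · rcases hkB with h | h <;> omega
    have h72 := hD72 hkk
    have e1 : coefOf s = Real.sqrt 3 / 24 := by rcases hsB with rfl | rfl <;> simp [coefOf]
    rw [coefOf_zero, lastOf_zero, e1, mul_zero, add_zero]; nlinarith
  · -- lifted / lifted
    have e1 : coefOf s = Real.sqrt 3 / 24 := by rcases hsB with rfl | rfl <;> simp [coefOf]
    have e2 : coefOf s' = Real.sqrt 3 / 24 := by rcases hsB' with rfl | rfl <;> simp [coefOf]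
    rw [e1, e2]
    by_cases hss : s = s'
    · subst hss
      have h48 : (D : ℝ) ≤ 48 := by
        exact_mod_cast idot_lift_le hiB hiB' hkB hkB' fun h => hne (by obtain ⟨rfl, rfl⟩ := h; rfl)
      have el : lastOf s * lastOf s = 1 / 4 := by rcases hsB with rfl | rfl <;> simp [lastOf] <;> norm_num
      rw [el]; nlinarith
    · have el : lastOf s * lastOf s' = -(1 / 4) := by
        rcases hsB with rfl | rfl <;> rcases hsB' with rfl | rfl <;> simp [lastOf] at hss ⊢ <;> norm_num
      rw [el]; nlinarith
  · -- lifted / pole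
    have e2 : coefOf s' = 0 := by rcases hsC' with rfl | rfl <;> simp [coefOf]
    have el : lastOf s * lastOf s' ≤ 1 / 2 := by
      rcases hsB with rfl | rfl <;> rcases hsC' with rfl | rfl <;> simp [lastOf]
    rw [e2]; linarith
  · -- pole / flat
    have e1 : coefOf s = 0 := by rcases hsC with rfl | rfl <;> simp [coefOf]
    rw [lastOf_zero, e1, zero_mul, zero_mul, mul_zero, zero_add]; norm_num
  · -- pole / lifted
    have e1 : coefOf s = 0 := by rcases hsC with rfl | rfl <;> simp [coefOf]
    have el : lastOf s * lastOf s' ≤ 1 / 2 := by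
      rcases hsC with rfl | rfl <;> rcases hsB' with rfl | rfl <;> simp [lastOf]
    rw [e1]; linarith
  · -- pole / pole
    have e1 : coefOf s = 0 := by rcases hsC with rfl | rfl <;> simp [coefOf]
    have hss : s ≠ s' := fun h => hne (by rw [h])
    have el : lastOf s * lastOf s' = -1 := by
      rcases hsC with rfl | rfl <;> rcases hsC' with rfl | rfl <;> simp [lastOf] at hss ⊢
    rw [e1, el]; norm_num

/-- `pt` is injective on the index set. -/
theorem pt_injOn : Set.InjOn pt idx := by
  intro q hq r hr h
  by_contra hne
  have h1 := inner_pt_le (mem_coe.mp hq) (mem_coe.mp hr) hne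
  rw [h, real_inner_self_eq_norm_sq, norm_pt (mem_coe.mp hr)] at h1
  norm_num at h1

/-- **`|conf| = 592`.** -/
theorem card_conf : conf.card = 592 := by
  rw [conf, card_image_of_injOn pt_injOn, card_idx]

/-- **`κ(11) ≥ 592`** (Ganzhinov 2022, §5.4): `592` unit vectors of `ℝ¹¹` with pairwise inner products `≤ 1/2`
(the record is `593`, AlphaEvolve 2025). [cite: Ganzhinov2022, §5.4, Table 2] -/
theorem exists_kissing_592 : ∃ C : Finset (EuclideanSpace ℝ (Fin 11)),
    C.card = 592 ∧ (∀ x ∈ C, ‖x‖ = 1) ∧ (∀ x ∈ C, ∀ y ∈ C, x ≠ y → inner ℝ x y ≤ 1 / 2) := by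
  refine ⟨conf, card_conf, fun x hx => ?_, fun x hx y hy hne => ?_⟩
  · obtain ⟨q, hq, rfl⟩ := mem_image.mp hx
    exact norm_pt hq
  · obtain ⟨q, hq, rfl⟩ := mem_image.mp hx
    obtain ⟨r, hr, rfl⟩ := mem_image.mp hy
    exact inner_pt_le hq hr fun h => hne (by rw [h])

/-- **`592 ≤ κ(11) ≤ 915` in Lean** (attained: Ganzhinov's configuration; upper: the cell's kernel-checked Delsarte LP
certificate; in print `κ(11) ≤ 868`). [cite: Ganzhinov2022, Table 2] -/
theorem kissing_dim11_bracket_592 :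
    (∃ C : Finset (EuclideanSpace ℝ (Fin 11)), C.card = 592 ∧ (∀ x ∈ C, ‖x‖ = 1) ∧
      (∀ x ∈ C, ∀ y ∈ C, x ≠ y → inner ℝ x y ≤ 1 / 2)) ∧
    ∀ C : Finset (EuclideanSpace ℝ (Fin 11)), (∀ x ∈ C, ‖x‖ = 1) →
      (∀ x ∈ C, ∀ y ∈ C, x ≠ y → inner ℝ x y ≤ 1 / 2) → C.card ≤ 915 :=
  ⟨exists_kissing_592, Kissing.kissing_dim11_le_915⟩

end Summit.Ventures.PackingBounds.Config.G11
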